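import Summits.BirchSwinnertonDyer.BirchSwinnertonDyer.Theorems.KolyvaginRoadThreeMethod2OddSelmerRank
import Literature.NumberTheory.EllipticCurves.CasselsTateLevelInputs
import Literature.NumberTheory.EllipticCurves.WeilPairingProofs
import Literature.NumberTheory.EllipticCurves.HeegnerPointsKolyvaginSelmerProofs
import Literature.NumberTheory.EllipticCurves.ShaFiniteProofs
import Literature.GroupTheory.FiniteAbelian.SymplecticModulesLevel
import Literature.Algebra.Module.AlternatingPairingParity
import HarnessLib

/-!
# Route `KolyvaginRoadThree`, deciding crux `ZhangSharpFrameAtThreeHL` (item stmt-BirchSwinnertonDyer-19574):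
# the 3-PARITY stub P `Method2.stub_oddSelmerRankAtThree` FROM THE ROUTE'S OWN BINDERS — the levelwise
# Cassels–Tate inputs `casselsTate_levelInputs` REPLACE the all-levels fact `exists_casselsTate_pairing`
# (cell `bsd-stepL`, OWNER seat `bsd-stepL-koly` g16; `--supports stmt-BirchSwinnertonDyer-19574`)

The registered METHOD skeleton v3 of crux 19574 (`Cruxes/ZhangSharpFrameAtThreeHL/Lines/method2.lean`) carries the
small stub P `stub_oddSelmerRankAtThree`: at every Hoffstein–Luo A1 frame `dim_𝔽₃ Sel₃(E/K)` is ODD. The sibling file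
`KolyvaginRoadThreeMethod2OddSelmerRank.lean` (koly g12, p465420) proves P's text VERBATIM from four named facts:
`gross_zagier`, `kolyvagin`, `hasEntireLFunction_rat` — conjuncts 1, 2, 7 of the route support
`PublishedInputsKolyThree` — and `WeierstrassCurve.exists_casselsTate_pairing` (Cassels 1962 ∕ Tate 1963 at ALL
levels), which is NOT a binder of the route's `closes`. The owner card of record (koly g15, CARD v3 §Stubs, «P
ORIENTATION note») left open «whether the route's own Cassels–Tate binder yields the evenness of `dim_𝔽₃ Ш(E/K)[3]`
that P needs — a short check for whoever orients P». THIS FILE IS THAT CHECK, in the kernel: P's registered text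
follows from the three `PublishedInputsKolyThree` conjuncts and the route's EXISTING binder
`hCT3 : ShimuraCasselsTateLevelInputs` (item stmt-BirchSwinnertonDyer-20191), which unfolds to
`∀ K, Literature.NumberTheory.EllipticCurves.casselsTate_levelInputs K` (the LEVELWISE Cassels–Tate inputs: for
`W/ℚ`, an odd prime power `q = p^{M₀}`, an involution of `K` and a Weil-type pairing on `E[q²]`, Milne's level-`q`
pairing on `Ш(E/K)[q]` is alternating with kernel `Ш[q] ∩ qШ`). No new named fact; nothing at level `2` or at all
levels is needed, because on an HL frame `Ш(E/K)` is FINITE (Kolyvagin), so ONE level `q = 3^k` killing `Ш[3^∞]`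
suffices: there the level pairing is non-degenerate on `Ш[3^k] = Ш[3^∞]`
(`Literature.GroupTheory.FiniteAbelian.nondegenerate_of_isLevelPairing`) and a finite abelian `3`-group with a
non-degenerate alternating `ℚ/ℤ`-valued pairing has even `3`-rank
(`Literature.Algebra.Module.exists_natCard_torsionBy_eq_pow_two_mul`); with `rank E(K) = 1` and `E(K)[3] = 0`,
`#Sel₃(E/K) = 3 · 1 · #Ш[3] = 3^{1+2m}` (`WeierstrassCurve.natCard_selmerGroup_eq`, AEC X.4.2).

CONSEQUENCE FOR THE PLANNER (option (o2) of the owner card, now turnkey): prefixing the crux decl (and P) with the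
binders `PublishedInputsKolyThree →` and `ShimuraCasselsTateLevelInputs →` — BOTH ALREADY binders `h₁`, `hCT3` of the
route's `closes` — makes P land BY NAME from `stub_oddSelmerRankAtThree_of_casselsTateLevelInputs` below (feed
`h₁.1.1`, `h₁.1.2.1`, `h₁.1.2.2.2.2.2.2.1`, `hCT3`); no bundle edit, no new support item, no Cassels–Tate fact at
level `2`. Under option (o1) (crux text unchanged) this file records P's terminal state as «P modulo three
conjuncts of 19156 + item 20191».

THEOREMS (0 defs, 0 named facts, 0 `sorry`): `odd_selmerRank_of_rankOne_of_finiteSha_of_levelPairings` (any number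
field: rank one + `Ш` finite + no `3`-torsion + a level pairing on `Ш[3^k]` at every `k ≥ 1` ⇒ `#Sel₃ = 3^s`, `s`
odd), `exists_isLevelPairing_sha_baseChange_of_casselsTateLevelInputs` (the route binder instantiated at `p = 3`
with the tree's Weil pairing `exists_weilPairing_holds` and the complex conjugation
`exists_conj_of_isImaginaryQuadratic`), and `stub_oddSelmerRankAtThree_of_casselsTateLevelInputs` — THE REGISTERED
STUB SIGNATURE as conclusion. CONDITIONAL on the named inputs (all published); closes nothing by itself (T7).
PARTITION: O2@3 (B10) × A1 × crux 19574 × stub P — proves-glue (orientation of P onto the route's binders).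

References: [cite: MilneADT2006, Ch. I §6, Prop. 6.9, Thm. 6.13(a)] [cite: Cassels1962ArithmeticIV]
[cite: SilvermanAEC2009, Thm. X.4.2, Prop. III.8.1] [cite: GrossZagier1986Heegner, Thm. I.6.3]
[cite: KolyvaginEulerSystems1990, Thm. A] [cite: WZhang2014, Thm. 9.2] [cite: GrossLMS1991, Prop. 2.3].
-/

noncomputable section

open scoped Classical AddSubgroup

namespace Summit.BirchSwinnertonDyer.Rank1Residual.X11b.Three.Koly.Method2

open WeierstrassCurve NumberField IsDedekindDomain Literature.NumberTheory.EllipticCurves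
  Literature.NumberTheory.EllipticCurves.ModularForms
  Literature.NumberTheory.EllipticCurves.Rank1Residual
  Literature.NumberTheory.GaloisRepresentations Literature.NumberTheory.GaloisCohomology
  Literature.GroupTheory.FiniteAbelian
  Summit.BirchSwinnertonDyer.Rank1Residual Summit.BirchSwinnertonDyer.Rank1Residual.X11b Module

/-! ## Rank one + `Ш` finite + no `3`-torsion + level pairings on `Ш[3^k]` ⇒ odd `3`-Selmer rank (any number field) -/

/-- **Odd `3`-Selmer rank from rank one, with the Cassels–Tate input in LEVELWISE form.** For an elliptic curve `E`
over a number field with `rank E(K) = 1`, `Ш(E/K)` finite and `E(K)[3] = 0`, granting at every level `3^k`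
(`k ≥ 1`) an alternating pairing on `Ш[3^k]` with kernel `Ш[3^k] ∩ 3^k Ш` (Milne's fixed-level Cassels–Tate
theorem, `IsLevelPairing`), `#Sel₃(E/K) = 3^s` with `s` ODD. Proof: `#Sel₃ = 3^{rank} · #E(K)[3] · #Ш[3]`
(AEC X.4.2, tree `natCard_selmerGroup_eq`); at a level `3^k` killing the finite `3`-group `Ш[3^∞]` the level pairing
is non-degenerate on `Ш[3^k] ⊇ Ш[3]`, so `#Ш[3] = 3^{2m}` (even `3`-rank of a finite symplectic `3`-group).
[cite: MilneADT2006, Ch. I §6, Thm. 6.13(a)] [cite: SilvermanAEC2009, Thm. X.4.2] -/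
theorem odd_selmerRank_of_rankOne_of_finiteSha_of_levelPairings {F : Type} [Field F] [NumberField F]
    (E : WeierstrassCurve F) [E.IsElliptic] (hrank : E.mordellWeilRank = 1) (hSha : Finite E.sha)
    (htors : AddSubgroup.torsionBy E.toAffine.Point ((3 : ℕ) : ℤ) = ⊥)
    (hlev : ∀ k : ℕ, 0 < k →
      ∃ B : (E.sha)[((3 ^ k : ℕ) : ℤ)] →+ (E.sha)[((3 ^ k : ℕ) : ℤ)] →+ AddCircle (1 : ℚ),
        IsLevelPairing (3 ^ k) B) :
    ∃ s : ℕ, Odd s ∧ Nat.card (E.selmerGroup ((3 : ℕ) : ℤ)) = 3 ^ s := by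
  haveI : Fact (Nat.Prime 3) := ⟨Nat.prime_three⟩
  haveI := hSha
  -- a level `3^k`, `k ≥ 1`, killing the `3`-primary part of the finite group `Ш`
  set k : ℕ := padicValNat 3 (Nat.card E.sha) + 1 with hkdef
  have hkpos : 0 < k := Nat.succ_pos _
  have hcard0 : Nat.card E.sha ≠ 0 := Nat.card_pos.ne'
  have hkill : ∀ z : E.sha, (∃ j : ℕ, 3 ^ j • z = 0) → 3 ^ k • z = 0 := by
    rintro z ⟨j, hj⟩
    have hdvd : addOrderOf z ∣ 3 ^ j := addOrderOf_dvd_iff_nsmul_eq_zero.mpr hj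
    obtain ⟨a, -, ha⟩ := (Nat.dvd_prime_pow Nat.prime_three).mp hdvd
    have han : 3 ^ a ∣ Nat.card E.sha := ha ▸ addOrderOf_dvd_natCard z
    have hale : a ≤ padicValNat 3 (Nat.card E.sha) := (padicValNat_dvd_iff_le hcard0).mp han
    have hak : addOrderOf z ∣ 3 ^ k := by
      rw [ha]
      exact pow_dvd_pow 3 (by omega)
    exact addOrderOf_dvd_iff_nsmul_eq_zero.mp hak
  have hq : ∀ z : E.sha, (3 ^ k * 3 ^ k) • z = 0 → 3 ^ k • z = 0 := fun z hz ↦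
    hkill z ⟨k + k, by rwa [pow_add]⟩
  obtain ⟨B, hB⟩ := hlev k hkpos
  -- the level pairing is non-degenerate on the finite `3`-group `Q = Ш[3^k]`
  have hnd : ∀ x : (E.sha)[((3 ^ k : ℕ) : ℤ)], (∀ y, B x y = 0) → x = 0 :=
    nondegenerate_of_isLevelPairing hB hq
  have hQ : ∀ q : (E.sha)[((3 ^ k : ℕ) : ℤ)], ∃ n : ℕ, 3 ^ n • q = 0 := fun q ↦
    ⟨k, Subtype.ext (by
      rw [AddSubgroupClass.coe_nsmul, ZeroMemClass.coe_zero]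
      have h := (Submodule.mem_torsionBy_iff _ _).mp q.2
      rwa [natCast_zsmul] at h)⟩
  obtain ⟨m, hm⟩ :=
    Literature.Algebra.Module.exists_natCard_torsionBy_eq_pow_two_mul (p := 3) hQ B hB.1 hnd
  -- `#Ш[3] = #Q[3] = 3^(2m)`
  have hle : (E.sha)[((3 : ℕ) : ℤ)] ≤ (E.sha)[((3 ^ k : ℕ) : ℤ)] := by
    intro x hx
    refine (Submodule.mem_torsionBy_iff _ _).mpr ?_
    have h3 : ((3 : ℕ) : ℤ) • x = 0 := (Submodule.mem_torsionBy_iff _ _).mp hx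
    obtain ⟨c, hc⟩ : ((3 : ℕ) : ℤ) ∣ ((3 ^ k : ℕ) : ℤ) := by
      exact_mod_cast dvd_pow_self 3 hkpos.ne'
    change ((3 ^ k : ℕ) : ℤ) • x = 0
    rw [hc, mul_comm, mul_zsmul, h3, zsmul_zero]
  have hSha3 : Nat.card ((E.sha)[((3 : ℕ) : ℤ)]) = 3 ^ (2 * m) := by
    rw [← hm, Literature.Algebra.Module.natCard_torsionBy_addSubgroup ((E.sha)[((3 ^ k : ℕ) : ℤ)])
      ((3 : ℕ) : ℤ), inf_eq_right.mpr hle]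
  -- `#Sel₃ = 3^rank · #E(K)[3] · #Ш[3]`
  have hSel := E.natCard_selmerGroup_eq (n := 3) (by norm_num)
  have ht : Nat.card (E.toAffine.Point[((3 : ℕ) : ℤ)]) = 1 := by
    rw [htors, AddSubgroup.card_bot]
  have hinf : Nat.card (E.sha ⊓ AddSubgroup.torsionBy E.galH1 ((3 : ℕ) : ℤ) : AddSubgroup E.galH1) =
      Nat.card ((E.sha)[((3 : ℕ) : ℤ)]) :=
    (Literature.Algebra.Module.natCard_torsionBy_addSubgroup E.sha ((3 : ℕ) : ℤ)).symm
  refine ⟨2 * m + 1, odd_two_mul_add_one m, ?_⟩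
  rw [hSel, hrank, ht, hinf, hSha3]
  ring

/-! ## The route binder `casselsTate_levelInputs` instantiated at `p = 3` -/

/-- **Level pairings on `Ш(E/K)[3^k]` from the route binder `casselsTate_levelInputs K`** (item 20191's decl), for
`E = W/ℚ` base-changed to an imaginary quadratic `K`: the binder is fed the complex conjugation of `K`
(`exists_conj_of_isImaginaryQuadratic`) and the Weil pairing on `E[3^{2k}]` (tree THEOREM `exists_weilPairing_holds`,
Silverman III.8.1), and its fourth output is Milne's level pairing at `q = 3^k`.
[cite: MilneADT2006, Ch. I §6, Prop. 6.9, Thm. 6.13(a)] [cite: SilvermanAEC2009, Prop. III.8.1] -/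
theorem exists_isLevelPairing_sha_baseChange_of_casselsTateLevelInputs {K : Type} [Field K] [NumberField K]
    (hCT : casselsTate_levelInputs K) (hK : IsImaginaryQuadratic K) (W : WeierstrassCurve ℚ) [W.IsElliptic]
    (k : ℕ) (hk : 0 < k) :
    ∃ B : ((W.baseChange K).sha)[((3 ^ k : ℕ) : ℤ)] →+ ((W.baseChange K).sha)[((3 ^ k : ℕ) : ℤ)] →+
        AddCircle (1 : ℚ), IsLevelPairing (3 ^ k) B := by
  haveI : NeZero (3 ^ k) := ⟨pow_ne_zero _ three_ne_zero⟩
  obtain ⟨c, hc, hcc⟩ := Literature.NumberTheory.EllipticCurves.exists_conj_of_isImaginaryQuadratic (K := K) hK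
  have h2 : 2 ≤ 3 ^ k * 3 ^ k :=
    le_trans (le_trans (by norm_num) (Nat.le_self_pow hk.ne' 3)) (Nat.le_mul_of_pos_right _ (NeZero.pos (3 ^ k)))
  have hq : ((3 ^ k * 3 ^ k : ℕ) : K) ≠ 0 := Nat.cast_ne_zero.mpr (NeZero.ne (3 ^ k * 3 ^ k))
  obtain ⟨e, hμ, hadd₁, hadd₂, halt, hnd, hgal⟩ := exists_weilPairing_holds (W.baseChange K) (3 ^ k * 3 ^ k) h2 hq
  obtain ⟨inv, hPT', hH3, -, hB, -⟩ :=
    hCT W 3 k Nat.prime_three (by decide) hk c hc hcc e hμ hadd₁ hadd₂ hgal halt hnd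
  exact ⟨_, hB⟩

/-! ## The stub from the route's binders -/

/-- **`Method2.stub_oddSelmerRankAtThree` (registered text of skeleton v3, VERBATIM) FROM THE ROUTE'S OWN BINDERS.**
At every Hoffstein–Luo A1 frame `dim_𝔽₃ Sel₃(E/K)` is odd, from: Gross–Zagier `hGZ` + modularity `hmod` (the
Heegner point `y_K` is non-torsion on the HL frame), Kolyvagin `hKo` (`rank E(K) = 1`, `Ш(E/K)` finite) — conjuncts
1, 2, 7 of `PublishedInputsKolyThree` — and the LEVELWISE Cassels–Tate inputs `hCT` (the decl of the route support
item stmt-BirchSwinnertonDyer-20191 `ShimuraCasselsTateLevelInputs`, already the binder `hCT3` of the route's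
`closes`), in place of the all-levels fact `exists_casselsTate_pairing` used by the sibling
`stub_oddSelmerRankAtThree_of_published`. `E(K)[3] = 0` from `Irr W 3` over the quadratic `K`. CONDITIONAL on the
four named inputs (all published). [cite: GrossZagier1986Heegner, Thm. I.6.3] [cite: KolyvaginEulerSystems1990,
Thm. A] [cite: MilneADT2006, Ch. I §6, Thm. 6.13(a)] [cite: WZhang2014, Thm. 9.2] -/
theorem stub_oddSelmerRankAtThree_of_casselsTateLevelInputs
    (hGZ : ∀ (N : ℕ) [NeZero N] (W : WeierstrassCurve ℚ) (K : Type) [Field K] [NumberField K], gross_zagier N W K)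
    (hKo : ∀ (N : ℕ) [NeZero N] (W : WeierstrassCurve ℚ) (K : Type) [Field K] [NumberField K], kolyvagin N W K)
    (hmod : hasEntireLFunction_rat)
    (hCT : ∀ (K : Type) [Field K] [NumberField K], casselsTate_levelInputs K) :
    ∀ (W : WeierstrassCurve ℚ) [W.IsElliptic] [W.IsGloballyMinimal] [NeZero (W.conductorNorm ℤ)] (K : Type)
      [Field K] [NumberField K] (Dt : ModularParametrizationData W (W.conductorNorm ℤ)) (β : ℤ) (ι : K →+* ℂ),
      Summit.BirchSwinnertonDyer.Rank1Residual.ClassX11b W 3 → W.HasMultiplicativeReductionAtPrime 3 →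
      Rank1Residual.Surj W 3 → Rank1Residual.Ram W 3 → ¬ 3 ∣ W.tamagawaProduct → IsImaginaryQuadratic K →
      Odd (NumberField.discr K) → SatisfiesHeegnerHypothesis (W.conductorNorm ℤ) K →
      (W.quadraticTwist (NumberField.discr K : ℚ)).entireLFunction 1 ≠ 0 → NumberField.discr K ≠ -3 →
      (4 * (W.conductorNorm ℤ : ℤ)) ∣ β ^ 2 - NumberField.discr K → ¬ (3 : ℤ) ∣ Dt.c →
      ∀ [Module (ZMod 3) (V3 W K)],
      Odd (finrank (ZMod 3)
        (AddSubgroup.toZModSubmodule 3 (selmerGroup (W.baseChange K) ((3 ^ 1 : ℕ) : ℤ)))) := by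
  intro W _ _ _ K _ _ Dt β ι hX _hmult _hsurj _hram _htam hK _hodd hH hLt _h3 hβ _hc _
  haveI : Fact (Nat.Prime 3) := ⟨Nat.prime_three⟩
  have hirr : Irr W 3 := hX.2.2.2
  -- `d_K < 0`
  have hDneg : NumberField.discr K < 0 := by
    have hND : IsCoprime (W.conductorNorm ℤ : ℤ) (NumberField.discr K) := by
      have h := Literature.SatisfiesHeegnerHypothesis.coprime_discr hK.1 hH
      refine Int.isCoprime_iff_gcd_eq_one.mpr ?_
      rw [Int.gcd_eq_natAbs, Int.natAbs_natCast]
      exact h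
    have hlt := Three.discr_lt_neg_four_of_isCoprime_of_dvd_sq_sub hK hND (Three.dvd_conductorNorm_of_classX11b hX) hβ
    omega
  -- THE Heegner point `P = y_K ∈ E(K)` of the frame, non-torsion by Gross–Zagier
  obtain ⟨H, -⟩ := exists_heegnerDatum (W.conductorNorm ℤ) hDneg hβ
  obtain ⟨P, hP⟩ := heegnerPointComplex_mem_range_map_holds (W.conductorNorm ℤ) W K hK hH Dt H ι
  have hPinf : ¬ IsOfFinAddOrder P :=
    not_isOfFinAddOrder_of_heegner_of_analyticRank_eq_one W (W.conductorNorm ℤ) K Dt H ι P (hGZ _ W K) hmod hX.1 hK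
      hH hLt hP
  -- Kolyvagin: rank one and `Ш(E/K)` finite; no `3`-torsion over `K`
  obtain ⟨hrank, hSha⟩ := hKo _ W K hK hH ⟨Dt, H, ι, hP⟩ hPinf
  have hbot := torsionBy_eq_bot_of_isImaginaryQuadratic_of_hasIrreducibleModPGaloisRep W K hK Nat.prime_three hirr
  -- the levelwise Cassels–Tate inputs at `p = 3`
  have hlev := fun k hk ↦ exists_isLevelPairing_sha_baseChange_of_casselsTateLevelInputs (hCT K) hK W k hk
  obtain ⟨s, hsodd, hs⟩ :=
    odd_selmerRank_of_rankOne_of_finiteSha_of_levelPairings (W.baseChange K) hrank hSha hbot hlev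
  rw [finrank_selmer_eq_of_natCard_eq_pow (W.baseChange K) hs]
  exact hsodd

end Summit.BirchSwinnertonDyer.Rank1Residual.X11b.Three.Koly.Method2

end
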